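import Literature.NumberTheory.LFunctions.ZeroCounting
import Literature.NumberTheory.LFunctions.ZeroDensityInghamHuxley
import Literature.NumberTheory.LFunctions.ZeroDensityIngham
import HarnessLib

/-!
# The Guth–Maynard exponent `15/(3+5σ)`: range bookkeeping for `zeroDensity_guth_maynard` (proofs only)

Trunk T-ANT (`Literature/NumberTheory/LFunctions`), family RH, statement **rh.S12**. First layer of
the decomposition of the named fact

* `Literature.NumberTheory.LFunctions.zeroDensity_guth_maynard :=
    ZeroDensityEstimate (fun σ ↦ 15 / (3 + 5 * σ)) (7 / 10)`
  (`ZeroCounting.lean`: `N(σ, T) ≪_ε T^{15(1−σ)/(3+5σ)+ε}` for `7/10 ≤ σ ≤ 1`).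

Companion of `ZeroDensityGuthMaynard.lean`, which does the same for the uniform exponent `30/13`
(`zeroDensity_thirty_thirteenths`); the two files are independent. PROOFS ONLY: no definition and
no named fact is introduced (D-0026), and the fact is not discharged here (see "What remains").

## Source, as printed

L. Guth, J. Maynard, *New large value estimates for Dirichlet polynomials*, Ann. of Math. (2) 203
(2026), no. 2 = arXiv:2405.20552:

* Theorem 1.2 (Zero density estimate), §1: "Let `N(σ,T)` denote the number of zeros `ρ` of `ζ(s)`
  with `Re(ρ) ≥ σ` and `|Im(ρ)| ≤ T`. Then we have `N(σ,T) ≤ T^{15(1−σ)/(3+5σ)+o(1)}`." No range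
  of `σ` is part of the printed statement.
* §13.1 (Proof of Theorem 1.2), first paragraph: "Theorem 1.2 follows from Ingham's result (1.3)
  [`N(σ,T) ≤ T^{3(1−σ)/(2−σ)+o(1)}`] if `σ ≤ 7/10` and Huxley's result (1.4)
  [`N(σ,T) ≤ T^{3(1−σ)/(3σ−1)+o(1)}`] if `σ ≥ 8/10`, so we may assume that `σ ∈ [7/10, 8/10]`."
  On that window the theorem is deduced from the large values estimate Theorem 1.1 by the
  zero-detecting method and the mean value theorem for Dirichlet polynomials.

The tree's `N(σ, T) = zetaZeroCountRe σ T` counts `0 < Im ρ ≤ T` (at most the printed two-sided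
count) and renders `T^{o(1)}` as `∀ ε > 0, … = O_{ε,σ}(T^{…+ε})` (`ZeroDensityEstimate`).

## What this file proves

* The two exponent comparisons of that paragraph with their exact crossover points:
  `3/(2−σ) ≤ 15/(3+5σ) ⟺ σ ≤ 7/10` (`ingham_exponent_le_guth_maynard_iff`) and
  `3/(3σ−1) ≤ 15/(3+5σ) ⟺ 4/5 ≤ σ` (`huxley_exponent_le_guth_maynard_iff`); and the NEGATIVE
  comparison `15/(3+5σ) < (5σ−3)/(σ²+σ−1)` on all of `[3/4, 1]`
  (`guth_maynard_exponent_lt_huxley1972_exponent`): Huxley's theorem in the monograph form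
  (28.19), which is PROVED in the tree (`Huxley1972_zeroDensity_holds`) and suffices for the `30/13`
  assembly, does not give the exponent `15/(3+5σ)` at any `σ`; the "`σ ≥ 8/10`" clause needs the
  Invent. Math. form `3/(3σ−1)`, the tree's named fact `Ivic1985_theorem11_1_huxley`.
* `isBigO_zetaZeroCountRe_guth_maynard_of_le_seven_tenths` — Theorem 1.2 on `1/2 ≤ σ ≤ 7/10`,
  UNCONDITIONALLY, from the tree's proved Ingham theorem `zeroDensity_ingham_holds`
  (`ZeroDensityIngham.lean`) — the "`σ ≤ 7/10`" clause.
* `zeroDensityEstimate_guth_maynard_half_iff` — consequently the tree's fact, stated on `[7/10, 1]`,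
  is EQUIVALENT to Theorem 1.2 read on the whole of `[1/2, 1]`
  (`ZeroDensityEstimate (fun σ ↦ 15/(3+5σ)) (1/2)`): the range chosen in `ZeroCounting.lean` loses
  nothing of the printed theorem.
* `zeroDensity_guth_maynard_of_window` — the reduction of `zeroDensity_guth_maynard` to (i) the
  bound on the window `7/10 ≤ σ ≤ 4/5` (an explicit hypothesis; the content of Guth–Maynard §§3–13)
  and (ii) `Ivic1985_theorem11_1_huxley` — the "`σ ≥ 8/10`" clause.

## What remains (status 2026-08-15)

`zeroDensity_guth_maynard_holds` is not written. After this file the missing inputs are exactly: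
(i) `N(σ, T) ≪_ε T^{15(1−σ)/(3+5σ)+ε}` for `7/10 ≤ σ ≤ 4/5` — Guth–Maynard Theorem 1.1 (the large
values estimate `R ≤ T^{o(1)}(N²V⁻² + N^{18/5}V⁻⁴ + TN^{12/5}V⁻⁴)`, §§3–12, absent from the tree)
fed through the zero-detecting method of §13.1 (the tree has a proved zero-detection layer,
`HuxleyZeroDetection.lean` / `HuxleyZeroDensity.lean`, and proved discrete mean value theorems,
`DirichletPolynomialGallagher.lean`); (ii) the discharge of `Ivic1985_theorem11_1_huxley`.

## References

* L. Guth, J. Maynard, *New large value estimates for Dirichlet polynomials*, Ann. of Math. (2)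
  203 (2026), no. 2; arXiv:2405.20552 — Theorems 1.1, 1.2, §13.1 (first paragraph).
* A. Ivić, *The Riemann Zeta-Function*, Wiley 1985, Thm 11.1 (11.22)–(11.23).
* M. N. Huxley, *The Distribution of Prime Numbers*, Oxford 1972, Ch. 28, (28.19);
  *On the difference between consecutive primes*, Invent. Math. 15 (1972), 164–170.
* A. E. Ingham, *On the estimation of `N(σ, T)`*, Quart. J. Math. Oxford 11 (1940), 291–292.
-/

noncomputable section

open Filter Asymptotics

namespace Literature.NumberTheory.LFunctions

/-! ## The exponent comparisons and their crossover points -/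

/-- Ingham's exponent versus the Guth–Maynard exponent: for `0 ≤ σ < 2`,
`3/(2−σ) ≤ 15/(3+5σ) ⟺ σ ≤ 7/10` (Guth–Maynard §13.1: "Theorem 1.2 follows from Ingham's result
(1.3) if `σ ≤ 7/10`"). [cite: GuthMaynard2026, Section 13.1] -/
theorem ingham_exponent_le_guth_maynard_iff {σ : ℝ} (h₀ : 0 ≤ σ) (h₂ : σ < 2) :
    3 / (2 - σ) ≤ 15 / (3 + 5 * σ) ↔ σ ≤ 7 / 10 := by
  rw [div_le_div_iff₀ (by linarith) (by linarith)]
  constructor <;> intro h <;> linarith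

/-- Huxley's exponent `3/(3σ−1)` (Invent. Math. 15 (1972); Ivić (11.23)) versus the Guth–Maynard
exponent: for `σ > 1/3`, `3/(3σ−1) ≤ 15/(3+5σ) ⟺ 4/5 ≤ σ` (Guth–Maynard §13.1: "… and Huxley's
result (1.4) if `σ ≥ 8/10`"). [cite: GuthMaynard2026, Section 13.1] -/
theorem huxley_exponent_le_guth_maynard_iff {σ : ℝ} (h₀ : 1 / 3 < σ) :
    3 / (3 * σ - 1) ≤ 15 / (3 + 5 * σ) ↔ 4 / 5 ≤ σ := by
  rw [div_le_div_iff₀ (by linarith) (by linarith)]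
  constructor <;> intro h <;> linarith

/-- The monograph form of Huxley's exponent, `(5σ−3)/(σ²+σ−1)` (Huxley 1972, Ch. 28, (28.19); the
tree's proved `Huxley1972_zeroDensity_holds`), is STRICTLY LARGER than the Guth–Maynard exponent at
every `3/4 ≤ σ ≤ 1`: `15(σ²+σ−1) < (5σ−3)(5σ+3) ⟺ 0 < 10σ² − 15σ + 6`, a quadratic with negative
discriminant `−15`. So (28.19) cannot supply the exponent `15/(3+5σ)` on `[4/5, 1]`. [cite: Huxley1972, Ch. 28, eq. (28.19)] -/
theorem guth_maynard_exponent_lt_huxley1972_exponent {σ : ℝ} (h₀ : 3 / 4 ≤ σ) :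
    15 / (3 + 5 * σ) < (5 * σ - 3) / (σ ^ 2 + σ - 1) := by
  have hden : 0 < σ ^ 2 + σ - 1 := by nlinarith
  rw [div_lt_div_iff₀ (by linarith) hden]
  nlinarith [mul_self_nonneg (σ - 3 / 4)]

/-! ## Theorem 1.2 below `σ = 7/10` is Ingham's theorem — unconditional in the tree -/

/-- **Guth–Maynard Theorem 1.2 on `1/2 ≤ σ ≤ 7/10`, unconditionally**:
`N(σ, T) ≪_ε T^{15(1−σ)/(3+5σ)+ε}` for `1/2 ≤ σ ≤ 7/10`, from Ingham's theorem (PROVED in the tree,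
`zeroDensity_ingham_holds`) and `3/(2−σ) ≤ 15/(3+5σ)` there — the "`σ ≤ 7/10`" clause of the first
paragraph of §13.1. [cite: GuthMaynard2026, Theorem 1.2 and Section 13.1] -/
theorem isBigO_zetaZeroCountRe_guth_maynard_of_le_seven_tenths {ε σ : ℝ} (hε : 0 < ε)
    (h₀ : 1 / 2 ≤ σ) (h₁ : σ ≤ 7 / 10) :
    (fun T : ℝ ↦ (zetaZeroCountRe σ T : ℝ)) =O[atTop]
      fun T : ℝ ↦ T ^ (15 / (3 + 5 * σ) * (1 - σ) + ε) :=
  zeroDensity_ingham_holds.isBigO_of_le hε h₀ (by linarith)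
    ((ingham_exponent_le_guth_maynard_iff (by linarith) (by linarith)).2 h₁)

/-- **Faithfulness of the range `[7/10, 1]`.** The tree's named fact `zeroDensity_guth_maynard`
(exponent `15/(3+5σ)` on `7/10 ≤ σ ≤ 1`) is equivalent to Theorem 1.2 read on the whole critical
half-strip `1/2 ≤ σ ≤ 1`, `ZeroDensityEstimate (fun σ ↦ 15/(3+5σ)) (1/2)`: the forward direction
is restriction of the range, the converse is the previous theorem on `[1/2, 7/10]`. [cite: GuthMaynard2026, Theorem 1.2 and Section 13.1] -/
theorem zeroDensityEstimate_guth_maynard_half_iff :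
    ZeroDensityEstimate (fun σ ↦ 15 / (3 + 5 * σ)) (1 / 2) ↔ zeroDensity_guth_maynard := by
  refine ⟨fun h ↦ h.of_le (by norm_num), fun h ε hε σ h₀ h₁ ↦ ?_⟩
  rcases le_total σ (7 / 10) with hσ | hσ
  · exact isBigO_zetaZeroCountRe_guth_maynard_of_le_seven_tenths hε h₀ hσ
  · exact h ε hε σ hσ h₁

/-! ## The reduction of `zeroDensity_guth_maynard` to the window (§13.1, first paragraph) -/

/-- **Reduction of the named fact `zeroDensity_guth_maynard` to the window `[7/10, 4/5]`.**
If (i) `N(σ, T) ≪_ε T^{15(1−σ)/(3+5σ)+ε}` holds for `7/10 ≤ σ ≤ 4/5` (the window on which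
Guth–Maynard prove Theorem 1.2 from their large values estimate Theorem 1.1, §13.1), and
(ii) Huxley's estimate `A(σ) ≤ 3/(3σ−1)` holds on `[3/4, 1]` (Ivić Thm 11.1 (11.23); the tree's named
fact `Ivic1985_theorem11_1_huxley`), then `zeroDensity_guth_maynard` holds: on `[4/5, 1]` one has
`3/(3σ−1) ≤ 15/(3+5σ)` (`huxley_exponent_le_guth_maynard_iff`) — the "`σ ≥ 8/10`" clause of the
first paragraph of §13.1. [cite: GuthMaynard2026, Section 13.1] -/
theorem zeroDensity_guth_maynard_of_window
    (hGM : ∀ ε > 0, ∀ σ : ℝ, 7 / 10 ≤ σ → σ ≤ 4 / 5 →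
      (fun T : ℝ ↦ (zetaZeroCountRe σ T : ℝ)) =O[atTop]
        fun T : ℝ ↦ T ^ (15 / (3 + 5 * σ) * (1 - σ) + ε))
    (hH : Ivic1985_theorem11_1_huxley) : zeroDensity_guth_maynard := by
  intro ε hε σ h₀ h₁
  rcases le_total σ (4 / 5) with hσ | hσ
  · exact hGM ε hε σ h₀ hσ
  · exact hH.isBigO_of_le hε (by linarith) h₁
      ((huxley_exponent_le_guth_maynard_iff (by linarith)).2 hσ)

/-- The same reduction with Theorem 1.2 read on the whole of `[1/2, 1]` as the conclusion
(`zeroDensityEstimate_guth_maynard_half_iff`). [cite: GuthMaynard2026, Theorem 1.2 and Section 13.1] -/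
theorem zeroDensityEstimate_guth_maynard_half_of_window
    (hGM : ∀ ε > 0, ∀ σ : ℝ, 7 / 10 ≤ σ → σ ≤ 4 / 5 →
      (fun T : ℝ ↦ (zetaZeroCountRe σ T : ℝ)) =O[atTop]
        fun T : ℝ ↦ T ^ (15 / (3 + 5 * σ) * (1 - σ) + ε))
    (hH : Ivic1985_theorem11_1_huxley) :
    ZeroDensityEstimate (fun σ ↦ 15 / (3 + 5 * σ)) (1 / 2) :=
  zeroDensityEstimate_guth_maynard_half_iff.2 (zeroDensity_guth_maynard_of_window hGM hH)

end Literature.NumberTheory.LFunctions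

end
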